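import Literature.AlgebraicGeometry.HodgeTheory.CMTypeOfCommutingRationalAction
import Literature.RingTheory.SimpleModule.MultiplicityFreeCommutant
import HarnessLib

/-!
# CM-type from a family of Hodge endomorphisms of `H¹` with commutative commutant — in particular from a MULTIPLICITY-FREE decomposition of `H¹(A(ℂ); ℂ)` («CM from the Hecke commutant»)

Family `hodge`, layer `Literature/AlgebraicGeometry/HodgeTheory`; THEOREMS ONLY (no definition, no named fact, no instance,
no `sorry`; D-0026).  Sequel of `CMTypeIffCentralizerCommutative` (the «multiplicity-one lever»
`isOfCMType_of_centralizer_bettiCohomology_comm`: a family `R ⊆ End A` whose pull-backs have a commutative commutant on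
`H¹(A(ℂ); ℚ)` forces CM-type) and of `CMTypeOfCommutingRationalAction` (Riemann's theorem
`deligneMilne1982_Thm_6_20_full_holds` moves from Hodge endomorphisms of `H¹` to `End A`).  Written for the cell
`hodgecm-mathlib` (D-0151), road «VI-1 ⇐ H413»: the Albanese variety of a compact unitary Shimura surface is of CM-type because
its `H¹` is a multiplicity-free sum of irreducible Hecke modules (Murty–Ramakrishnan, CRM Proc. Lecture Notes 1 (1992), §2;
Deligne, LNM 900 (1982), I §5) — NOTHING automorphic is stated here: the acting family, its Hodge property and the
decomposition are hypotheses.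

## What is proved (unconditional, sorry-free), for a complex abelian variety `A` and `H¹ = H¹(A(ℂ); ℚ)` (`bettiCohomology A.X 1`)

* §1 `isOfCMType_of_centralizer_comm_of_isHodgeMorphismOne` — if `S ⊆ End_ℚ H¹` consists of morphisms of rational Hodge
  structures of weight one (`IsHodgeMorphismOne A A`) and any two `ℚ`-endomorphisms of `H¹` commuting with `S` commute with each
  other, then `A` is of CM-type.  (Riemann: each `s ∈ S` is `k⁻¹ u^*` with `u ∈ End A`, so Milne's commutant `C(A)` — the
  endomorphisms commuting with every `u^*` — lies in the commutant of `S`, which is commutative; then the lever.)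
* §2 `isOfCMType_of_centralizer_baseChange_comm_of_isHodgeMorphismOne` — the same with the commutativity hypothesis read after
  `⊗ ℂ`: any two `ℂ`-endomorphisms of `ℂ ⊗_ℚ H¹` commuting with the `s ⊗ 1`, `s ∈ S`, commute (base change of endomorphisms is
  injective and multiplicative).
* §3 **`isOfCMType_of_multiplicityFree_of_isHodgeMorphismOne`** — THE MULTIPLICITY-ONE CRITERION: if `ℂ ⊗_ℚ H¹ = ⊕ᵢ Wᵢ` is an
  internal direct sum of `S ⊗ 1`-stable subspaces which are `S ⊗ 1`-simple and pairwise `S ⊗ 1`-non-isomorphic (every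
  `S ⊗ 1`-equivariant `ℂ`-linear map `Wᵢ → Wⱼ`, `i ≠ j`, vanishes — Schur's form), then `A` is of CM-type: the commutant of
  `S ⊗ 1` is commutative by `RingTheory/SimpleModule/MultiplicityFreeCommutant` (`MultiplicityFree.commute_of_forall_commute`),
  and §2 applies.  This is the abstract form of «multiplicity one for the `H¹`-cohomological automorphic representations +
  Hecke correspondences are Hodge endomorphisms ⇒ `Alb` is of CM-type».

The formulation is ours; the nearest printed statements are Deligne I §5 Prop. 5.1 (proof: «E is the commutant of G in
End(H₁(A,ℚ)) […] It follows that E is a commutative field») and Milne 1999 Rem. 1.10 («This shows that π(A) is commutative»).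

## References
* [Deligne1982HodgeCycles] P. Deligne, *Hodge cycles on abelian varieties*, LNM 900 (1982), I §5 Prop. 5.1 (proof).
* [Milne1999] J. S. Milne, *Lefschetz motives and the Tate conjecture*, Compositio Math. 117 (1999), §1 Remark 1.10 (p. 53).
* [DeligneMilne1982Tannakian] P. Deligne, J. S. Milne, *Tannakian categories*, LNM 900 (1982), II Thm. 6.20 (Riemann), p. 212.
* [BourbakiAlgebreVIII2012] N. Bourbaki, *Algèbre, Ch. VIII* (2012), §4 n°6 Prop. 4 b), Prop. 5 b) (pp. VIII.61–62) — Schur for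
  multiplicity-free semisimple modules (the tree's `MultiplicityFreeCommutant`).
-/

noncomputable section

open CategoryTheory
open Literature.AlgebraicGeometry Literature.AlgebraicGeometry.Motives
open Literature.AlgebraicGeometry.Milne1999 (IsOfCMType)
open scoped TensorProduct

namespace Literature.AlgebraicGeometry.HodgeTheory

variable {A : AbelianVariety ℂ}

/-! ## §1 Hodge endomorphisms with commutative commutant force CM-type -/

/-- **CM-type from a family of Hodge endomorphisms of `H¹` whose commutant is commutative.**  Let `S ⊆ End_ℚ H¹(A(ℂ); ℚ)`
consist of morphisms of rational Hodge structures of weight one, and suppose any two `ℚ`-endomorphisms of `H¹` commuting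
with all of `S` commute with each other.  Then `A` is of CM-type.  Proof: by Riemann's theorem
(`deligneMilne1982_Thm_6_20_full_holds`) every `s ∈ S` is `k⁻¹ u^*` for some `u ∈ End A`, `k ≥ 1`; hence an element of Milne's
commutant `C(A)` (a rational endomorphism commuting with every `u^*`, `u ∈ End A`) commutes with `S`, so `C(A)` is commutative
and the lever `isOfCMType_of_centralizer_bettiCohomology_comm` applies.  The formulation is ours.
[cite: Deligne1982HodgeCycles, I §5 Prop. 5.1 (proof)] [cite: Milne1999, §1 Remark 1.10 (p. 53)] [cite: DeligneMilne1982Tannakian, II Thm. 6.20, p. 212] -/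
theorem isOfCMType_of_centralizer_comm_of_isHodgeMorphismOne (S : Set (Module.End ℚ (bettiCohomology A.X 1)))
    (hS : ∀ s ∈ S, IsHodgeMorphismOne A A s)
    (hcomm : ∀ x y : Module.End ℚ (bettiCohomology A.X 1),
      (∀ s ∈ S, x * s = s * x) → (∀ s ∈ S, y * s = s * y) → x * y = y * x) :
    IsOfCMType A := by
  -- an endomorphism commuting with every `u^*` commutes with every Hodge endomorphism `s = k⁻¹ u^*`
  have key : ∀ x : Module.End ℚ (bettiCohomology A.X 1),
      (∀ φ : A ⟶ A, (bettiCohomology.map φ.hom.hom.hom 1).hom * x = x * (bettiCohomology.map φ.hom.hom.hom 1).hom) →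
      ∀ s ∈ S, x * s = s * x := by
    intro x hx s hs
    obtain ⟨u, k, hk, hu⟩ := deligneMilne1982_Thm_6_20_full_holds A A s
      (nonempty_hodgeModel_holds.nonempty AbelianVariety.isSmoothProjective_holds) (hS s hs)
    have hu' : (bettiCohomology.map u.hom.hom.hom 1).hom = (k : ℚ) • s := by
      apply LinearMap.ext
      intro v
      rw [LinearMap.smul_apply, Nat.cast_smul_eq_nsmul]
      exact hu v
    have hxu := hx u
    rw [hu', smul_mul_assoc, mul_smul_comm] at hxu
    have hk' : (k : ℚ) ≠ 0 := Nat.cast_ne_zero.2 hk.ne'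
    exact (smul_right_injective (Module.End ℚ (bettiCohomology A.X 1)) hk' hxu).symm
  refine isOfCMType_of_centralizer_bettiCohomology_comm (Set.univ : Set (A ⟶ A)) fun x y hx hy => ?_
  exact hcomm x y (key x fun φ => hx φ (Set.mem_univ φ)) (key y fun φ => hy φ (Set.mem_univ φ))

/-! ## §2 The commutant read after `⊗ ℂ` -/

/-- Base change `ℚ → ℂ` of endomorphisms of a finite-dimensional `ℚ`-space is injective (entrywise on matrices). [folklore] -/
private theorem baseChange_complex_injective {V : Type*} [AddCommGroup V] [Module ℚ V] [FiniteDimensional ℚ V] :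
    Function.Injective fun t : Module.End ℚ V => t.baseChange ℂ := by
  classical
  intro s t hst
  let b := Module.finBasis ℚ V
  have h := congrArg (LinearMap.toMatrix (Algebra.TensorProduct.basis ℂ b) (Algebra.TensorProduct.basis ℂ b)) hst
  simp only [LinearMap.toMatrix_baseChange] at h
  exact (LinearMap.toMatrix b b).injective (Matrix.map_injective (algebraMap ℚ ℂ).injective h)

/-- **CM-type from Hodge endomorphisms whose COMPLEXIFIED commutant is commutative.**  As in §1, with the commutativity
hypothesis on `ℂ ⊗_ℚ H¹`: any two `ℂ`-endomorphisms commuting with all `s ⊗ 1`, `s ∈ S`, commute.  (For rational `x`, `y`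
commuting with `S`, `x ⊗ 1` and `y ⊗ 1` commute with the `s ⊗ 1`, hence with each other, and `t ↦ t ⊗ 1` is injective and
multiplicative.) The formulation is ours. [cite: Deligne1982HodgeCycles, I §5 Prop. 5.1 (proof)] [cite: Milne1999, §1 Remark 1.10 (p. 53)] -/
theorem isOfCMType_of_centralizer_baseChange_comm_of_isHodgeMorphismOne (S : Set (Module.End ℚ (bettiCohomology A.X 1)))
    (hS : ∀ s ∈ S, IsHodgeMorphismOne A A s)
    (hcomm : ∀ x y : Module.End ℂ (ℂ ⊗[ℚ] bettiCohomology A.X 1),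
      (∀ s ∈ S, x * s.baseChange ℂ = s.baseChange ℂ * x) → (∀ s ∈ S, y * s.baseChange ℂ = s.baseChange ℂ * y) →
        x * y = y * x) :
    IsOfCMType A := by
  haveI : Module.Finite ℚ (bettiCohomology A.X 1) :=
    finite_singularCohomology_rat_complexPoints (AbelianVariety.isSmoothProjective_holds (A := A)) 1
  refine isOfCMType_of_centralizer_comm_of_isHodgeMorphismOne S hS fun x y hx hy => ?_
  apply baseChange_complex_injective
  show (x * y).baseChange ℂ = (y * x).baseChange ℂ
  rw [LinearMap.baseChange_mul, LinearMap.baseChange_mul]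
  exact hcomm _ _ (fun s hs => by rw [← LinearMap.baseChange_mul, hx s hs, LinearMap.baseChange_mul])
    (fun s hs => by rw [← LinearMap.baseChange_mul, hy s hs, LinearMap.baseChange_mul])

/-! ## §3 The multiplicity-one criterion -/

/-- **CM-type from a multiplicity-free decomposition of `H¹(A(ℂ); ℂ)` under Hodge endomorphisms** («CM from the Hecke
commutant»).  Let `S ⊆ End_ℚ H¹(A(ℂ); ℚ)` consist of morphisms of rational Hodge structures of weight one, and let
`ℂ ⊗_ℚ H¹ = ⊕ᵢ Wᵢ` (`iSupIndep W`, `⨆ W = ⊤`) be an internal direct sum of subspaces stable under the `s ⊗ 1`, `s ∈ S`, which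
are `S`-SIMPLE (`Wᵢ ≠ 0` and a non-zero `S`-stable subspace of `Wᵢ` is `Wᵢ`) and PAIRWISE `S`-NON-ISOMORPHIC in Schur's form (for
`i ≠ j` every `ℂ`-linear map carrying `Wᵢ` into `Wⱼ` and commuting with the `s ⊗ 1` on `Wᵢ` vanishes on `Wᵢ`).  Then `A` is of
CM-type: the commutant of `{s ⊗ 1}` is commutative (`MultiplicityFree.commute_of_forall_commute`, Schur's lemma for a
multiplicity-free semisimple module) and §2 applies.  Intended use: `S` = Hecke correspondences on `H¹` of an Albanese
variety, `Wᵢ` = the `K`-fixed vectors of the irreducible automorphic constituents, each of multiplicity one.  The formulation is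
ours. [cite: Deligne1982HodgeCycles, I §5 Prop. 5.1 (proof)] [cite: Milne1999, §1 Remark 1.10 (p. 53)]
[cite: BourbakiAlgebreVIII2012, §4 n°6 Prop. 4 b) and Prop. 5 b) (pp. VIII.61–62)] -/
theorem isOfCMType_of_multiplicityFree_of_isHodgeMorphismOne (S : Set (Module.End ℚ (bettiCohomology A.X 1)))
    (hS : ∀ s ∈ S, IsHodgeMorphismOne A A s) {ι : Type*} (W : ι → Submodule ℂ (ℂ ⊗[ℚ] bettiCohomology A.X 1))
    (ind : iSupIndep W) (top : ⨆ i, W i = ⊤)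
    (hstab : ∀ i, ∀ s ∈ S, ∀ x ∈ W i, s.baseChange ℂ x ∈ W i)
    (hzero : ∀ i j, i ≠ j → ∀ f : Module.End ℂ (ℂ ⊗[ℚ] bettiCohomology A.X 1), (∀ x ∈ W i, f x ∈ W j) →
      (∀ s ∈ S, ∀ x ∈ W i, f (s.baseChange ℂ x) = s.baseChange ℂ (f x)) → ∀ x ∈ W i, f x = 0)
    (hsimple : ∀ i, W i ≠ ⊥ ∧ ∀ U : Submodule ℂ (ℂ ⊗[ℚ] bettiCohomology A.X 1), U ≤ W i → U ≠ ⊥ →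
      (∀ s ∈ S, ∀ x ∈ U, s.baseChange ℂ x ∈ U) → U = W i) :
    IsOfCMType A := by
  haveI : Module.Finite ℚ (bettiCohomology A.X 1) :=
    finite_singularCohomology_rat_complexPoints (AbelianVariety.isSmoothProjective_holds (A := A)) 1
  -- the family `S ⊗ 1 ⊆ End_ℂ (ℂ ⊗ H¹)` and the hypotheses read on it
  set Sc : Set (Module.End ℂ (ℂ ⊗[ℚ] bettiCohomology A.X 1)) := (fun s => s.baseChange ℂ) '' S with hSc
  have hstab' : ∀ i, ∀ t ∈ Sc, ∀ x ∈ W i, t x ∈ W i := by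
    rintro i _ ⟨s, hs, rfl⟩ x hx
    exact hstab i s hs x hx
  have hzero' : ∀ i j, i ≠ j → ∀ f : Module.End ℂ (ℂ ⊗[ℚ] bettiCohomology A.X 1), (∀ x ∈ W i, f x ∈ W j) →
      (∀ t ∈ Sc, ∀ x ∈ W i, f (t x) = t (f x)) → ∀ x ∈ W i, f x = 0 :=
    fun i j hij f hf hfS => hzero i j hij f hf fun s hs x hx => hfS _ ⟨s, hs, rfl⟩ x hx
  have hsimple' : ∀ i, W i ≠ ⊥ ∧ ∀ U : Submodule ℂ (ℂ ⊗[ℚ] bettiCohomology A.X 1), U ≤ W i → U ≠ ⊥ →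
      (∀ t ∈ Sc, ∀ x ∈ U, t x ∈ U) → U = W i :=
    fun i => ⟨(hsimple i).1, fun U hU hU0 hUS => (hsimple i).2 U hU hU0 fun s hs x hx => hUS _ ⟨s, hs, rfl⟩ x hx⟩
  have hfin : ∀ i, FiniteDimensional ℂ (W i) := fun i => inferInstance
  refine isOfCMType_of_centralizer_baseChange_comm_of_isHodgeMorphismOne S hS fun x y hx hy => ?_
  exact Literature.RingTheory.SimpleModule.MultiplicityFree.commute_of_forall_commute ind top hstab' hzero' hsimple' hfin
    (fun t ⟨s, hs, ht⟩ => by rw [← ht]; exact hx s hs) (fun t ⟨s, hs, ht⟩ => by rw [← ht]; exact hy s hs)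

end Literature.AlgebraicGeometry.HodgeTheory

end
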